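/-
  MomentLaw.lean — plan-lens-HodgeAV-extremal g13 (node «cover-integrality law», row L3′ = Ω), EVIDENCE-LEVEL KERNEL FILE.
  The SIXTEEN signed-moment identities of an integer design whose fourteen mixed `{e,ē}` class coefficients vanish
  (memo-13 §1 (ii)), in the vocabulary of `I2CongruenceCensus` §6 (negation g16), whose `mu_law_eight` is the pair of
  identities `b = (true,true,true,true)` ∕ one `false`.  For a sign vector `b : Fin 4 → Bool` put
      X_b := Σ_c ν_c ∏_f halfG (c f) (b f)      (halfG true = (x, 0) = x,  halfG false = (0, −y) = −iy),
  i.e. `X_b = (−i)^{#false} · Σ_c ν_c ∏_{b_f} x_f ∏_{¬b_f} y_f` — an INTEGER moment of the letters actually placed (no base cell, no phases).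
  THEOREM `moment_law`:  16 · X_b = T(eeee) + (∏_f signG (b f)) · T(ēēēē)  for all sixteen `b`.
  (Pen, memo-13 §1: conversely the sixteen identities imply the fourteen vanishing coefficients, the sign-weight matrix being Hadamard.)
  Nothing here is a statement about designs with (A4), floors, 18881, H2 or HC; census-neutral; no `sorry`, no new axioms.
-/
import Summits.HodgeConjecture.HodgeConjecture.Cruxes.BlochSeedDiscOne.I2CongruenceCensus

namespace Summit.HodgeConjecture.HodgeConjecture.Cruxes.BlochSeedDiscOne.I2CongruenceCensus

/-- the signed moment of the sign vector `b`: `X_b := Σ_c ν_c ∏_f halfG (c f) (b f)`. -/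
def momentG (D : DesignEE) (b : Fin 4 → Bool) : GaussianInt :=
  (D.map fun p => (p.2 : GaussianInt) * ∏ f, halfG (p.1 f) (b f)).sum

/-- per cell: `∏_f (β̄_f + s_f β_f) = 16 · ∏_f halfG` for sign weights. -/
theorem prod_factor_two (c : Fin 4 → ℤ × ℤ) (b : Fin 4 → Bool) :
    ∏ f, (coefEE (c f) true + signG (b f) * coefEE (c f) false) = ((16 : ℤ) : GaussianInt) * ∏ f, halfG (c f) (b f) := by
  have e : ∏ f, (coefEE (c f) true + signG (b f) * coefEE (c f) false)
      = (∏ _f : Fin 4, ((2 : ℤ) : GaussianInt)) * ∏ f, halfG (c f) (b f) := by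
    rw [← Finset.prod_mul_distrib]
    exact Finset.prod_congr rfl fun f _ => factor_two (c f) (b f)
  rw [e, Finset.prod_const, Finset.card_univ, Fintype.card_fin]
  push_cast; norm_num

/-- design level: the signed word sum equals `16 · X_b` (no (A1) assumed). -/
theorem wordsum_eq_sixteen_moment (D : DesignEE) (b : Fin 4 → Bool) :
    ∑ w : Fin 4 → Bool, (∏ f, (if w f then (1 : GaussianInt) else signG (b f))) * TEE D w
      = ((16 : ℤ) : GaussianInt) * momentG D b := by
  rw [design_wordsum]
  unfold momentG
  rw [← List.sum_map_mul_left]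
  congr 1
  apply List.map_congr_left
  intro p _
  rw [prod_factor_two]; ring

/-- THE MOMENT LAW (sixteen identities, one per sign vector `b`): for every integer design whose fourteen mixed `{e,ē}`
class coefficients vanish, `16 · X_b = μ + (∏_f signG (b f)) · T(ēēēē)`. -/
theorem moment_law (D : DesignEE)
    (hA : ∀ w : Fin 4 → Bool, w ≠ (fun _ => true) → w ≠ (fun _ => false) → TEE D w = 0) (b : Fin 4 → Bool) :
    ((16 : ℤ) : GaussianInt) * momentG D b = muEE D + (∏ f, signG (b f)) * TEE D (fun _ => false) := by
  rw [← wordsum_eq_sixteen_moment D b, wordsum_of_A1 D hA (fun f => signG (b f))]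
  rfl

/-- the all-`true` identity: `16 · Σ_c ν_c ∏_f x_f = μ + T(ēēēē)` (= `2 Re μ`, pen). -/
theorem moment_law_true (D : DesignEE)
    (hA : ∀ w : Fin 4 → Bool, w ≠ (fun _ => true) → w ≠ (fun _ => false) → TEE D w = 0) :
    ((16 : ℤ) : GaussianInt) * momentG D (fun _ => true) = muEE D + TEE D (fun _ => false) := by
  have h := moment_law D hA (fun _ => true)
  have s1 : ∏ f : Fin 4, signG ((fun _ : Fin 4 => true) f) = 1 := by
    rw [Fin.prod_univ_four]; simp [signG]
  rw [s1, one_mul] at h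
  exact h

/-! ### Sanity instance: the eighth-coset carrier `E₈` on `β = 2 + 2i` in all four slots (memo-13 §2, `EighthCosetCarrier.lean`),
as a `DesignEE` with the ROTATED letters written out (`i^k (2+2i)` for `k = 0,1,2,3` ↦ `(2,2), (−2,2), (−2,−2), (2,−2)`). -/

/-- the four rotations of `β = 2 + 2i`. -/
def rotB (k : Fin 4) : ℤ × ℤ := ![((2 : ℤ), (2 : ℤ)), (-2, 2), (-2, -2), (2, -2)] k

/-- `E₈ = {0000, 1300, 1030, 1003, 0130, 0103, 0013, 1111}` applied slotwise to `(2+2i, 2+2i, 2+2i, 2+2i)`, multiplicity `1` each. -/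
def E8design : DesignEE :=
  [ (![rotB 0, rotB 0, rotB 0, rotB 0], 1), (![rotB 1, rotB 3, rotB 0, rotB 0], 1), (![rotB 1, rotB 0, rotB 3, rotB 0], 1),
    (![rotB 1, rotB 0, rotB 0, rotB 3], 1), (![rotB 0, rotB 1, rotB 3, rotB 0], 1), (![rotB 0, rotB 1, rotB 0, rotB 3], 1),
    (![rotB 0, rotB 0, rotB 1, rotB 3], 1), (![rotB 1, rotB 1, rotB 1, rotB 1], 1) ]

/-- `E₈` kills all fourteen mixed `{e,ē}` class coefficients … -/
theorem E8design_A1 : ∀ w : Fin 4 → Bool, w ≠ (fun _ => true) → w ≠ (fun _ => false) → TEE E8design w = 0 := by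
  decide

/-- … carries `μ = 8 · (2 − 2i)⁴ = −512` … -/
theorem E8design_mu : muEE E8design = ⟨-512, 0⟩ := by decide

/-- … and its all-`true` moment is `X = Σ ∏ x_f = −64`, so that `16 · X = −1024 = μ + μ̄` as `moment_law_true` demands. -/
theorem E8design_moment_true : momentG E8design (fun _ => true) = ⟨-64, 0⟩ := by decide

example : ((16 : ℤ) : GaussianInt) * momentG E8design (fun _ => true) = muEE E8design + TEE E8design (fun _ => false) :=
  moment_law_true E8design E8design_A1

end Summit.HodgeConjecture.HodgeConjecture.Cruxes.BlochSeedDiscOne.I2CongruenceCensus
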